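import Summits.BirchSwinnertonDyer.BirchSwinnertonDyer.Theorems.PrintCf2RamifiedOffTYZMoverSumBlocksSixAll
import Summits.BirchSwinnertonDyer.BirchSwinnertonDyer.Theorems.PrintCf2RamifiedOffTYZSelmerRankOneMoverSix
import Literature.NumberTheory.EllipticCurves.CongruentNumberMonskySelmerParitySelmer
import HarnessLib

/-!
# Crux `PrintCf2.RamifiedOffTYZOfFacts` (stmt-BirchSwinnertonDyer-20509), line `offtyz-v7`, LEAD cycle 14 (cruxlead-20509 g13):
# `#Sel₂(E_n) = 8 ⟹ BSD(E_n, 2)` FOR `n ≡ 6 (mod 8)` WITHOUT CLASS-NUMBER PARITIES — the `s = 1` stratum through the regime-free block form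

THEOREMS ONLY (no `def`, no named fact, no `sorry`), `--supports stmt-BirchSwinnertonDyer-20509` (the `s = 1`, `n ≡ 6 (8)` stratum of item 23432
`RamifiedOffJumpOneOfFacts`).  Sequel of `…MoverSumBlocksSixAll` (the even block sum in every regime) and of g9's `…SelmerRankOneMoverSix` /
`…SelmerRankOneSixGenus` / `…SelmerRankOneSixOfFacts`, whose arithmetic hypothesis «`g(2d_S)` odd on the even blocks of odd cofactor parity» is
REMOVED: the only hypothesis left besides `#Sel₂(E_n) = 8` and the printed displays is
  «`adj(M_even)_{(inl i)(inr i)} = 1` for some `i`»  (= `u_{inl i} = 1` for the Selmer kernel vector `u`, `adjugate_monskyEven_inl_inr_eq_kerSum`),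
a Legendre-symbol condition on the prime factors (LEAD census: 1803 of the 1843 square-free `n ≡ 6 (8)`, `n ≤ 20000`, `k ≤ 4`, with `s(n) = 1` — all of
`k ≤ 2`).
* §1 `rankOne_sha_bsdp_two_of_card_selmer_eight_six_all` (prime-tuple form, display hypotheses on every block incl. `ρ₄` and the Frobenius classes (F4)).
* §2 `…_of_displays` (from `D.Printed ∧ D.CMPointRingClassFrobeniusValuePrinted`), §3 `…_of_facts` / the `OfFacts` arrow from the named facts
  `tyz_cmPointRingClassFrobeniusValueData ∧ thm11_parity_of_scriptL` (ty2 p733876; TYZ Thm 1.1).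
BSD is not proved by any of this (conditional on the two printed facts); no class is closed by this file.

References: [cite: TianYuanZhang2017, Thm. 1.1, §3.1, Prop. 3.2 (2), Thm. 3.5, Thm. 3.6 (2), Lemma 3.18, proof of Lemma 3.21];
[cite: HeathBrown1994SelmerCongruentII, Appendix (Monsky), typescript p. 41 L20–L36]; [cite: Smith2016CongruentDensity, Thm. 1.2, §2];
[cite: Cox2013, §5.C Lemma 5.19, (5.22), Thm. 5.23, Cor. 5.25, §9.A]; [cite: Miller2011LMS, Def. 1.1]; [cite: Rotman1995, Thm. 2.19].
-/

noncomputable section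

open scoped Classical NumberField

open WeierstrassCurve WeierstrassCurve.Affine Finset Matrix Literature.NumberTheory.EllipticCurves
  Literature.NumberTheory.EllipticCurves.TianYuanZhang2017
  Literature.NumberTheory.EllipticCurves.TianYuanZhang2017.W2
  Literature.NumberTheory.EllipticCurves.HeathBrown1994
  Literature.NumberTheory.EllipticCurves.HeathBrown1994.Families
  Literature.NumberTheory.EllipticCurves.Smith2016
  Literature.NumberTheory.EllipticCurves.MonskySelmerParity
  Literature.NumberTheory.QuadraticFields.RingClass
  Literature.NumberTheory.QuadraticFields
  Summit.BirchSwinnertonDyer.Rank1Residual.P2.GenusPeriodTransferLayer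
  Summit.BirchSwinnertonDyer.Rank1Residual.P2.ThetaDescent
  Summit.BirchSwinnertonDyer.Rank1Residual.P2
  Summit.BirchSwinnertonDyer.PrintCf2.QForm
  Summit.BirchSwinnertonDyer.PrintCf2.QFormForest

set_option autoImplicit false

namespace Summit.BirchSwinnertonDyer.PrintCf2.MoverAssembly

variable {k : ℕ} (p : Fin k → ℕ) (hp : ∀ i, (p i).Prime) (hodd : ∀ i, Odd (p i)) (hinj : Function.Injective p)
variable {n : ℕ} (D : GenusPointData n)

/-! ## §1 The `s = 1` stratum for `n ≡ 6 (mod 8)`, all regimes -/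

include hp hodd hinj in
/-- **A SQUARE MOVER OF `P(n)` EXISTS, all regimes**: `n = 2p₁⋯p_k ≡ 6 (mod 8)`, `adj(M_even)_{(inl i)(inr i)} = 1` for some `i`, the displayed CM-point
layer on every block with the lift of `σ_{1+ϖ}`, the ring class dictionary `ρ₄` and the Frobenius classes (F4) on every block `d ≡ 6 (mod 8)`, TYZ Thm 1.1
⟹ some `h` has `(hh)·P(n) ≠ P(n)` (the Kummer element pointed at `pᵢ`, `sqMover_six_of_adjugate_eq_one_all`).
[cite: TianYuanZhang2017, §3.1 (p0011 L53–L73), Prop. 3.2 (2), Thm. 3.6 (2), proof of Lemma 3.21 (p0020 L27–L63), Thm. 1.1] -/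
theorem exists_sq_mover_six_all (hn : n = 2 * ∏ i, p i) (h3 : (∏ i, p i) % 4 = 3) (hrec : D.recursion) (hLs : D.scriptLSpec)
    (z : ℕ → APoint D.H) (Φ : ℕ → Finset (D.H ≃ₐ[ℚ] D.H)) (ΓH ΓH' : ℕ → Subgroup (D.H ≃ₐ[ℚ] D.H))
    (σ θ : ℕ → (D.H ≃ₐ[ℚ] D.H)) (c : D.H ≃ₐ[ℚ] D.H) (hc : D.ConjSpec c)
    (ρ₄ : (d : ℕ) → (D.galK d →* RingClassGroup (GenusField d) 4))
    (hblock : ∀ d ∈ n.divisors, ((d % 8 = 5 ∨ d % 8 = 6) → D.CMBlockSpec d (z d) (Φ d) (ΓH d) (ΓH' d) (σ d) c) ∧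
      (d % 8 = 7 → D.SevenBlockSpec d))
    (htheta : ∀ d ∈ n.divisors, d % 8 = 6 → D.ThetaBlockSpec d (z d) (ΓH d) (ΓH' d) (σ d) (θ d))
    (hring : ∀ d ∈ n.divisors, d % 8 = 6 → D.RingClassFourBlockSpec d (ΓH d) (ΓH' d) (ρ₄ d))
    (hval : ∀ d ∈ n.divisors, d % 8 = 6 → D.FrobeniusFourValueBlockSpec d (ΓH' d) (ρ₄ d))
    (h11 : thm11_parity_of_scriptL) (i : Fin k)
    (hadj : (monskyMatrixEven p).adjugate (Sum.inl i) (Sum.inr i) = 1) :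
    ∃ h : D.H ≃ₐ[ℚ] D.H, D.galPt (h * h) (D.P n) ≠ D.P n := by
  obtain ⟨h, hhi, hh2, hhp⟩ := exists_kummer_element p hp hodd hinj D hn i
  exact ⟨h, sqMover_six_of_adjugate_eq_one_all p hp hodd hinj D hn h3 hrec hLs z Φ ΓH ΓH' σ θ c hc ρ₄ hblock htheta hring hval h11 i
    hhi hh2 hhp hadj⟩

include hp hodd hinj in
/-- **THE `s = 1` STRATUM FOR `n ≡ 6 (mod 8)`, ALL REGIMES, THROUGH THE EVEN DOOR.**  For `n = 2p₁⋯p_k` with `p₁⋯p_k ≡ 3 (mod 4)`,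
`#Sel⁽²⁾(E_n/ℚ) = 8` and some `i` with `adj(M_even)_{(inl i)(inr i)} = 1`, granted the printed Tian–Yuan–Zhang §3 data on `n` (genus-point displays
`recursion`, `thm35Main`, `scriptLSpec`, `lemma318`; the CM-point layer on every block; on the blocks `d ≡ 6 (mod 8)` the lift of `σ_{1+ϖ}`, the ring class
dictionary `ρ₄ : Gal(ℍ′_n/K_d) ↠ Pic(𝒪₄)` and the Frobenius elements of the odd primes with their classes) and Thm 1.1 — and NO class-number parity:
`ord_{s=1} L(E_n, s) = 1`, `rank E_n(ℚ) = 1`, `Ш(E_n/ℚ)[2^∞] = 0`, and `BSD(E_n, 2)`.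
[cite: TianYuanZhang2017, Thm. 1.1, §3.1, Prop. 3.2 (2), Thm. 3.5, Thm. 3.6 (2), Lemma 3.18, proof of Lemma 3.21]
[cite: HeathBrown1994SelmerCongruentII, Appendix (Monsky), typescript p. 41 L20–L36] [cite: Smith2016CongruentDensity, Thm. 1.2] [cite: Miller2011LMS, Def. 1.1] -/
theorem rankOne_sha_bsdp_two_of_card_selmer_eight_six_all (hn : n = 2 * ∏ i, p i) (h3 : (∏ i, p i) % 4 = 3)
    (hrec : D.recursion) (h35 : D.thm35Main) (hLs : D.scriptLSpec) (h318 : D.lemma318)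
    (z : ℕ → APoint D.H) (Φ : ℕ → Finset (D.H ≃ₐ[ℚ] D.H)) (ΓH ΓH' : ℕ → Subgroup (D.H ≃ₐ[ℚ] D.H))
    (σ θ : ℕ → (D.H ≃ₐ[ℚ] D.H)) (c : D.H ≃ₐ[ℚ] D.H) (hc : D.ConjSpec c)
    (ρ₄ : (d : ℕ) → (D.galK d →* RingClassGroup (GenusField d) 4))
    (hblock : ∀ d ∈ n.divisors, ((d % 8 = 5 ∨ d % 8 = 6) → D.CMBlockSpec d (z d) (Φ d) (ΓH d) (ΓH' d) (σ d) c) ∧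
      (d % 8 = 7 → D.SevenBlockSpec d))
    (htheta : ∀ d ∈ n.divisors, d % 8 = 6 → D.ThetaBlockSpec d (z d) (ΓH d) (ΓH' d) (σ d) (θ d))
    (hring : ∀ d ∈ n.divisors, d % 8 = 6 → D.RingClassFourBlockSpec d (ΓH d) (ΓH' d) (ρ₄ d))
    (hval : ∀ d ∈ n.divisors, d % 8 = 6 → D.FrobeniusFourValueBlockSpec d (ΓH' d) (ρ₄ d))
    (h11 : thm11_parity_of_scriptL) (i : Fin k)
    (hadj : (monskyMatrixEven p).adjugate (Sum.inl i) (Sum.inr i) = 1)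
    (hsel : haveI := isElliptic_congruentNumberCurve (show n ≠ 0 by
        rw [hn]; exact mul_ne_zero two_ne_zero (Finset.prod_ne_zero_iff.mpr fun i _ => (hp i).ne_zero));
      Nat.card ((congruentNumberCurve n).selmerGroup 2) = 8) :
    haveI := isElliptic_congruentNumberCurve (show n ≠ 0 by
      rw [hn]; exact mul_ne_zero two_ne_zero (Finset.prod_ne_zero_iff.mpr fun i _ => (hp i).ne_zero))
    (congruentNumberCurve n).analyticRank = 1 ∧ (congruentNumberCurve n).mordellWeilRank = 1 ∧
      AddCommGroup.primaryComponent (congruentNumberCurve n).sha 2 = ⊥ ∧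
      BSDp (congruentNumberCurve n) 2 := by
  have hsq : Squarefree n := by
    rw [hn, ← prod_cons_two_eq p]
    exact squarefree_prod_of_injective _ (prime_cons_two p hp) (injective_cons_two p hodd hinj)
  have hmodd : Odd (∏ i, p i) := odd_prod p hp (ne_two_of_odd p hodd)
  have h6 : n % 8 = 6 := by rcases hmodd with ⟨r, hr⟩; omega
  obtain ⟨h, hmove⟩ := exists_sq_mover_six_all p hp hodd hinj D hn h3 hrec hLs z Φ ΓH ΓH' σ θ c hc ρ₄ hblock htheta hring hval h11 i hadj
  exact GaloisMotion.rankOne_sha_bsdp_two_congruentNumberCurve_of_selmerEight_of_mover_even hsq h6 hsel D h35 hLs h318 (h * h)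
    (mul_self_apply_im D h) (fun d hd => mul_self_apply_sqrtNeg D h hd) hmove

/-! ## §2 From the per-`n` displays -/

/-- **THE `s = 1` STRATUM FOR A SQUARE-FREE `n ≡ 6 (mod 8)`, display shape, all regimes.**  For square-free `n ≡ 6 (mod 8)` with `#Sel⁽²⁾(E_n/ℚ) = 8`,
an enumeration `n = 2p₁⋯p_k` of its odd primes with `adj(M_even)_{(inl i)(inr i)} = 1` for some `i`, data `D : GenusPointData n` with `D.Printed` and
`D.CMPointRingClassFrobeniusValuePrinted` (ty2 p733876), and TYZ Thm 1.1: `ord_{s=1} L(E_n,s) = 1`, `rank E_n(ℚ) = 1`, `Ш(E_n)[2^∞] = 0`, `BSD(E_n, 2)` —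
NO class-number parity (compare `rankOne_sha_bsdp_two_of_selmerEight_six_of_displays`).
[cite: TianYuanZhang2017, Thm. 1.1 and §3 (Prop. 3.2 (2), Thm. 3.5, Thm. 3.6 (2), Lemma 3.18, proof of Lemma 3.21)]
[cite: HeathBrown1994SelmerCongruentII, Appendix (Monsky), typescript p. 41 L20–L36] [cite: Cox2013, §5.C Thm. 5.23, Cor. 5.25, §9.A] [cite: Miller2011LMS, Def. 1.1] -/
theorem rankOne_sha_bsdp_two_of_selmerEight_six_all_of_displays {n : ℕ} (hsq : Squarefree n) (h6 : n % 8 = 6)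
    (D : GenusPointData n) (hPr : D.Printed) (hCM : D.CMPointRingClassFrobeniusValuePrinted) (h11 : thm11_parity_of_scriptL)
    (hadj : ∃ (k : ℕ) (p : Fin k → ℕ), (∀ i, (p i).Prime) ∧ Function.Injective p ∧ 2 * ∏ i, p i = n ∧
      ∃ i, (monskyMatrixEven p).adjugate (Sum.inl i) (Sum.inr i) = 1)
    (hsel : haveI := isElliptic_congruentNumberCurve hsq.ne_zero; Nat.card ((congruentNumberCurve n).selmerGroup 2) = 8) :
    haveI := isElliptic_congruentNumberCurve hsq.ne_zero
    (congruentNumberCurve n).analyticRank = 1 ∧ (congruentNumberCurve n).mordellWeilRank = 1 ∧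
      AddCommGroup.primaryComponent (congruentNumberCurve n).sha 2 = ⊥ ∧ BSDp (congruentNumberCurve n) 2 := by
  obtain ⟨k, p, hp, hinj, hprod, i, hadj⟩ := hadj
  have hp2 : ∀ i, p i ≠ 2 := by
    intro j hj
    have h4 : 2 * 2 ∣ n := by
      rw [← hprod, ← hj]
      exact Nat.mul_dvd_mul_left _ (Finset.dvd_prod_of_mem p (mem_univ j))
    exact absurd (hsq 2 h4) (by decide)
  have hpodd : ∀ i, Odd (p i) := fun i => (hp i).odd_of_ne_two (hp2 i)
  have hmodd : Odd (∏ i, p i) := odd_prod p hp hp2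
  have h3 : (∏ i, p i) % 4 = 3 := by rcases hmodd with ⟨r, hr⟩; omega
  obtain ⟨z, Φ, ΓH, ΓH', σ, θ, c, ρ₂, ρ₄, hc, hall⟩ := hCM
  obtain ⟨hLs, -, hrec, -, h35, -, -, -, h318, -, -⟩ := hPr
  exact rankOne_sha_bsdp_two_of_card_selmer_eight_six_all p hp hpodd hinj D hprod.symm h3 hrec h35 hLs h318 z Φ ΓH ΓH' σ θ c hc ρ₄
    (fun d hd => ⟨(hall d hd).1, (hall d hd).2.2.1⟩) (fun d hd h6d => (hall d hd).2.1 h6d)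
    (fun d hd h6d => (hall d hd).2.2.2.2.1 h6d) (fun d hd h6d => (hall d hd).2.2.2.2.2.2.2 h6d) h11 i hadj hsel

/-! ## §3 From the named facts -/

/-- **THE MINIMAL-SELMER CASE AT `p = 2` FOR `n ≡ 6 (mod 8)`, all regimes, from the named facts.**  Granted Tian–Yuan–Zhang 2017 §3 as printed with the
ring class dictionaries, the Frobenius elements of the ramified odd primes and their classes (`tyz_cmPointRingClassFrobeniusValueData`) and TYZ Thm 1.1
(`thm11_parity_of_scriptL`): for every square-free `n ≡ 6 (mod 8)` with `#Sel⁽²⁾(E_n/ℚ) = 8` whose Monsky kernel vector has a non-zero first block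
(`adj(M_even)_{(inl i)(inr i)} = 1` for some `i`, in some enumeration of the odd primes): `ord_{s=1} L(E_n, s) = 1`, `rank E_n(ℚ) = 1`, `Ш(E_n/ℚ)[2^∞] = 0`
and `BSD(E_n, 2)`.  [cite: TianYuanZhang2017, Thm. 1.1 and §3] [cite: HeathBrown1994SelmerCongruentII, Appendix (Monsky)] [cite: Miller2011LMS, Def. 1.1] -/
theorem rankOne_sha_bsdp_two_of_selmerEight_six_all_of_facts (hF : tyz_cmPointRingClassFrobeniusValueData) (h11 : thm11_parity_of_scriptL)
    {n : ℕ} (hsq : Squarefree n) (h6 : n % 8 = 6)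
    (hadj : ∃ (k : ℕ) (p : Fin k → ℕ), (∀ i, (p i).Prime) ∧ Function.Injective p ∧ 2 * ∏ i, p i = n ∧
      ∃ i, (monskyMatrixEven p).adjugate (Sum.inl i) (Sum.inr i) = 1)
    (hsel : haveI := isElliptic_congruentNumberCurve hsq.ne_zero; Nat.card ((congruentNumberCurve n).selmerGroup 2) = 8) :
    haveI := isElliptic_congruentNumberCurve hsq.ne_zero
    (congruentNumberCurve n).analyticRank = 1 ∧ (congruentNumberCurve n).mordellWeilRank = 1 ∧
      AddCommGroup.primaryComponent (congruentNumberCurve n).sha 2 = ⊥ ∧ BSDp (congruentNumberCurve n) 2 := by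
  obtain ⟨D, hPr, hCM⟩ := hF n hsq (Or.inr (Or.inl h6))
  exact rankOne_sha_bsdp_two_of_selmerEight_six_all_of_displays hsq h6 D hPr hCM h11 hadj hsel

/-- **`OfFacts` shape for the planner (aside under item 23432, `s = 1`, `n ≡ 6 (mod 8)`, all regimes)**: the conjunction of the two printed facts implies,
for every square-free `n ≡ 6 (mod 8)` with `#Sel₂(E_n) = 8` and a non-zero first block of the Monsky kernel vector, `ord = rank = 1`, `Ш[2^∞] = 0` and
BSD(E_n, 2). [cite: TianYuanZhang2017, Thm. 1.1 and §3] [cite: Miller2011LMS, Def. 1.1] -/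
theorem selmerEight_mod_eight_six_bsdp_two_all_of_facts :
    (tyz_cmPointRingClassFrobeniusValueData ∧ thm11_parity_of_scriptL) →
      ∀ n : ℕ, (hsq : Squarefree n) → n % 8 = 6 →
        (∃ (k : ℕ) (p : Fin k → ℕ), (∀ i, (p i).Prime) ∧ Function.Injective p ∧ 2 * ∏ i, p i = n ∧
          ∃ i, (monskyMatrixEven p).adjugate (Sum.inl i) (Sum.inr i) = 1) →
        (haveI := isElliptic_congruentNumberCurve hsq.ne_zero; Nat.card ((congruentNumberCurve n).selmerGroup 2) = 8) →
        haveI := isElliptic_congruentNumberCurve hsq.ne_zero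
        (congruentNumberCurve n).analyticRank = 1 ∧ (congruentNumberCurve n).mordellWeilRank = 1 ∧
          AddCommGroup.primaryComponent (congruentNumberCurve n).sha 2 = ⊥ ∧ BSDp (congruentNumberCurve n) 2 :=
  fun h _ hsq h6 hadj hsel => rankOne_sha_bsdp_two_of_selmerEight_six_all_of_facts h.1 h.2 hsq h6 hadj hsel

end Summit.BirchSwinnertonDyer.PrintCf2.MoverAssembly

end
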